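import Mathlib
import Literature.NumberTheory.LFunctions.Zhang2022.TypedAppendixA2
import Literature.NumberTheory.LFunctions.Zhang2022.AppendixAKappa2PrimePowers
import Literature.NumberTheory.LFunctions.Zhang2022.AppendixAEulerFactorM2
import Literature.NumberTheory.LFunctions.Zhang2022.AppendixALemma161
import Literature.NumberTheory.LFunctions.Zhang2022.AppendixALemma161Bridge

/-!
# Zhang (2022) Appendix A, proof of Lemma 16.1 (vi): `κ̃₂(qʳ;d)`, `ξ₂(qʳ;d,l)`, `λ̃₂(q,d)` and the local series for general `d, l`

Topic `Literature/NumberTheory/LFunctions/Zhang2022` (Landau–Siegel audit tree; verdict-neutral).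
Y. Zhang, *Discrete mean estimates and the Landau–Siegel zero*, arXiv:2211.02515v1 (2022)
[Zhang2022LandauSiegel] — **an unrefereed manuscript under adjudication**; this file PROVES exact
identities for the campaign's typed §16 objects (L4-t4 `Typed.Section16A`) at prime powers, for GENERAL
`d, l` (the companion `AppendixALemma161Bridge` did `d = l = 1`), and asserts nothing about the
manuscript's theorems. Campaign D-0069, DAG nodes `Z22:§A.u033`, `Z22:§A.u034` [Z22 p. 105,
tex L5195–L5204], (16.7), (16.8).

* `kappaTilde2_prime_pow_of_dvd` — `κ̃₂(qʲ;r) = κ₂(qʲ)` whenever `q ∣ r`;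
* `kappaTilde2_prime_pow_succ` — `κ̃₂(qʳ⁺¹;d) = c_d·wʳ(w−1)`, `c_d = (1 − wχ(q)/q)⁻¹` if `(q,d)=1` else `1`;
* `xi2_prime_pow` — **u033**: `ξ₂(qʳ;d,l) = κ̃₂(qʳ;d) − χ(q)q/(q−1)·κ₂(q^{r−1})` if `(q,l)=1`, else
  `κ̃₂(qʳ;d)` — the body of `Typed.AppendixA2.StepA_u033`;
* `norm_kappa2_prime_pow` — **u034** identity `|κ₂(qʳ)| = |q^{−β₁} − 1|` (body of `StepA_u034a`);
* `lamTilde2_prime` — `λ̃₂(q,d) = λ₂(q) = locLam` if `(q,d) = 1`, else `1`;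
* `xi2LocalSeries_prime` — the local series `Σ_{r≥1}ξ₂(qʳ;d,l)q^{−rs}` in CLOSED FORM for all `d, l`:
  `c_d(w−1)x/(1−wx) − [q∤l]·χ(q)q/(q−1)·x(1−x)/(1−wx)`.

Sequels: `AppendixALemma161Estimates` (generic inequalities), `AppendixALemma161StepsTyped` (the typed
nodes u033–u037 and `Lem161_pf`).

## References
* Y. Zhang, arXiv:2211.02515v1 (2022), §16 pp. 90–92, Appendix A pp. 104–105.
  [cite: Zhang2022LandauSiegel, §16, App. A p. 105]
-/

noncomputable section

open Complex Real Finset Filter Topology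
open ArithmeticFunction hiding log

namespace Literature.NumberTheory.LFunctions.Zhang2022.AppendixA

open MeanSquareMajorant
open Literature.NumberTheory.LFunctions.Zhang2022.Typed

/-! ## §1. `κ̃₂(qʳ;d)`, `ξ₂(qʳ;d,l)`, `λ̃₂(q,d)` at a prime, for general `d, l` -/

section GeneralDL

variable (c' : ℝ) {D : ℕ} (χ : DirichletCharacter ℂ D)

open scoped Classical in
/-- **`κ̃₂(qʲ;r) = κ₂(qʲ)` whenever `q ∣ r`** (only `h = 1` among the powers of `q` is coprime to `r`);
the manuscript's "`κ̃₂(q^{r−1}, dq) = κ₂(q^{r−1})`" (App. A (A.5) pattern p. 104, u033 p. 105).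
[cite: Zhang2022LandauSiegel, App. A p. 105] -/
theorem kappaTilde2_prime_pow_of_dvd {q : ℕ} (hq : q.Prime) (j : ℕ) {r : ℕ} (hqr : q ∣ r) :
    Section16A.kappaTilde2 c' χ (q ^ j) r 1 = Section16A.kappa2 c' D (q ^ j) := by
  unfold Section16A.kappaTilde2
  rcases j with _ | j
  · rw [pow_zero, tsum_eq_single 1]
    · simp [(mem_nset_one_iff 1).mpr rfl]
    · intro h hh
      rw [if_neg]
      rintro ⟨hn, -⟩
      exact hh ((mem_nset_one_iff h).mp hn)
  · have h1 := tsum_nset_prime_pow (r := j + 1) hq (by omega) (fun h => Nat.Coprime h r)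
      (fun h => Section16A.kappa2 c' D (q ^ (j + 1) * h) * χ (h : ZMod D) / (h : ℂ) ^ (1 : ℂ))
    calc (∑' h : ℕ, if h ∈ Skeleton.nset (q ^ (j + 1)) ∧ Nat.Coprime h r then
            Section16A.kappa2 c' D (q ^ (j + 1) * h) * χ (h : ZMod D) / (h : ℂ) ^ (1 : ℂ) else 0)
        = ∑' i : ℕ, if Nat.Coprime (q ^ i) r then
            Section16A.kappa2 c' D (q ^ (j + 1) * q ^ i) * χ ((q ^ i : ℕ) : ZMod D) /
              ((q ^ i : ℕ) : ℂ) ^ (1 : ℂ) else 0 := by convert h1 using 4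
      _ = Section16A.kappa2 c' D (q ^ (j + 1)) := by
          rw [tsum_eq_single 0]
          · rw [if_pos (by simp), pow_zero, mul_one, Nat.cast_one, Nat.cast_one, map_one,
              Complex.one_cpow, mul_one, div_one]
          · intro i hi
            rw [if_neg]
            intro hc
            exact hq.ne_one ((Nat.Coprime.of_dvd_right hqr hc).symm.eq_one_of_dvd (dvd_pow_self q hi))

open scoped Classical in
/-- **`κ̃₂(qʳ⁺¹;d) = c_d · wʳ(w − 1)`** for every `d` (`q` prime, `w = q^{−ib₁}`), with
`c_d = (1 − wχ(q)/q)⁻¹` if `(q,d) = 1` (geometric series over `h = qⁱ`) and `c_d = 1` if `q ∣ d` (only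
`h = 1`). [cite: Zhang2022LandauSiegel, App. A p. 105] -/
theorem kappaTilde2_prime_pow_succ {q : ℕ} (hq : q.Prime) (r d : ℕ) :
    Section16A.kappaTilde2 c' χ (q ^ (r + 1)) d 1 =
      (if Nat.Coprime q d then (1 - powI (Skeleton.b1 c' D) q * (χ (q : ZMod D) / q))⁻¹ else 1) *
        (powI (Skeleton.b1 c' D) q ^ r * (powI (Skeleton.b1 c' D) q - 1)) := by
  by_cases hqd : Nat.Coprime q d
  · rw [if_pos hqd]
    have hz : ‖χ (q : ZMod D) / (q : ℂ)‖ < 1 := by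
      rw [norm_div, Complex.norm_natCast]
      have h1 := DirichletCharacter.norm_le_one χ (q : ZMod D)
      have h2 : (2 : ℝ) ≤ q := by exact_mod_cast hq.two_le
      rw [div_lt_one (by linarith)]; linarith
    unfold Section16A.kappaTilde2
    have h1 := tsum_nset_prime_pow (r := r + 1) hq (by omega) (fun h => Nat.Coprime h d)
      (fun h => Section16A.kappa2 c' D (q ^ (r + 1) * h) * χ (h : ZMod D) / (h : ℂ) ^ (1 : ℂ))
    calc (∑' h : ℕ, if h ∈ Skeleton.nset (q ^ (r + 1)) ∧ Nat.Coprime h d then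
            Section16A.kappa2 c' D (q ^ (r + 1) * h) * χ (h : ZMod D) / (h : ℂ) ^ (1 : ℂ) else 0)
        = ∑' i : ℕ, if Nat.Coprime (q ^ i) d then
            Section16A.kappa2 c' D (q ^ (r + 1) * q ^ i) * χ ((q ^ i : ℕ) : ZMod D) /
              ((q ^ i : ℕ) : ℂ) ^ (1 : ℂ) else 0 := by convert h1 using 4
      _ = ∑' i : ℕ, kappa₂ (Skeleton.b1 c' D) (q ^ (r + 1 + i)) * (χ (q : ZMod D) / q) ^ i :=
          tsum_congr fun i => by
            rw [if_pos (Nat.Coprime.pow_left i hqd), Section16A.kappa2, ← pow_add, Complex.cpow_one,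
              Nat.cast_pow, Nat.cast_pow, map_pow χ, div_pow, mul_div_assoc]
      _ = _ := by
          rw [tsum_kappa₂_prime_pow_mul_pow (Skeleton.b1 c' D) hq r hz, div_eq_mul_inv, mul_comm]
  · rw [if_neg hqd, one_mul]
    have hqd' : q ∣ d := by
      rcases Nat.coprime_or_dvd_of_prime hq d with h | h
      · exact absurd h hqd
      · exact h
    rw [kappaTilde2_prime_pow_of_dvd c' χ hq (r + 1) hqd', Section16A.kappa2,
      kappa₂_apply_prime_pow_succ _ hq]

/-- **u033** [Z22 p. 105, tex L5195]: "For any `q, r, d, l`: `ξ₂(qʳ;d,l) = κ̃₂(qʳ;d) − χ(q)q(q−1)⁻¹κ₂(q^{r−1})`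
if `(q,l) = 1`, `= κ̃₂(qʳ;d)` if `q ∣ l`" — PROVED for the typed `Section16A.xi2` (`q` prime, `r ≥ 1`,
all `d, l`): among the divisors `k = qⁱ` of `qʳ` only `k = 1` and (when `(q,l) = 1`) `k = q` carry
`μ(k) ≠ 0`, and `κ̃₂(q^{r−1}; dq) = κ₂(q^{r−1})`. The body of `Typed.AppendixA2.StepA_u033`.
[cite: Zhang2022LandauSiegel, App. A p. 105] -/
theorem xi2_prime_pow {q r : ℕ} (d l : ℕ) (hq : q.Prime) (hr : 1 ≤ r) :
    Section16A.xi2 c' χ (q ^ r) d l =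
      if Nat.Coprime q l then
        Section16A.kappaTilde2 c' χ (q ^ r) d 1 -
          χ (q : ZMod D) * (q : ℂ) / ((q : ℂ) - 1) * Section16A.kappa2 c' D (q ^ (r - 1))
      else Section16A.kappaTilde2 c' χ (q ^ r) d 1 := by
  obtain ⟨r, rfl⟩ : ∃ r', r = r' + 1 := ⟨r - 1, by omega⟩
  rw [Nat.add_sub_cancel]
  unfold Section16A.xi2
  rw [Nat.divisors_prime_pow hq, Finset.filter_map, Finset.sum_map]
  simp only [Function.Embedding.coeFn_mk, Function.comp_def]
  have hq1 : ((q - 1 : ℕ) : ℂ) = (q : ℂ) - 1 := by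
    rw [Nat.cast_sub hq.one_lt.le, Nat.cast_one]
  have hμ : ∀ i : ℕ, (ArithmeticFunction.moebius (q ^ (i + 2)) : ℂ) = 0 := fun i => by
    have h2 : ¬ Squarefree (q ^ (i + 2)) := by
      rw [pow_add]
      exact fun h => hq.one_lt.ne' (Nat.isUnit_iff.mp (h q ⟨q ^ i, by ring⟩))
    rw [ArithmeticFunction.moebius_eq_zero_of_not_squarefree h2, Int.cast_zero]
  by_cases hql : Nat.Coprime q l
  · rw [if_pos hql]
    have hfilt : (Finset.range (r + 1 + 1)).filter (fun i => Nat.Coprime (q ^ i) l) =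
        Finset.range (r + 1 + 1) :=
      Finset.filter_true_of_mem fun i _ => Nat.Coprime.pow_left i hql
    rw [hfilt, Finset.sum_range_succ', Finset.sum_range_succ']
    have h0 : ∑ i ∈ Finset.range r,
        (ArithmeticFunction.moebius (q ^ (i + 1 + 1)) : ℂ) * χ ((q ^ (i + 1 + 1) : ℕ) : ZMod D) *
          ((q ^ (i + 1 + 1) : ℕ) : ℂ) / (Nat.totient (q ^ (i + 1 + 1)) : ℂ) *
          Section16A.kappaTilde2 c' χ (q ^ (r + 1) / q ^ (i + 1 + 1)) (d * q ^ (i + 1 + 1)) 1 = 0 :=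
      Finset.sum_eq_zero fun i _ => by rw [hμ i]; simp
    rw [h0, zero_add, pow_zero, pow_one, Nat.div_one, mul_one,
      Nat.div_eq_of_eq_mul_left hq.pos (pow_succ q r),
      kappaTilde2_prime_pow_of_dvd c' χ hq r (Dvd.intro_left d rfl),
      ArithmeticFunction.moebius_apply_prime hq, ArithmeticFunction.moebius_apply_one,
      Nat.totient_prime hq, Nat.totient_one, Nat.cast_one, map_one, hq1]
    push_cast
    ring
  · rw [if_neg hql]
    have hfilt : (Finset.range (r + 1 + 1)).filter (fun i => Nat.Coprime (q ^ i) l) = {0} := by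
      ext i
      simp only [Finset.mem_filter, Finset.mem_range, Finset.mem_singleton]
      constructor
      · rintro ⟨-, hc⟩
        by_contra hi
        exact hql (Nat.Coprime.coprime_dvd_left (dvd_pow_self q hi) hc)
      · rintro rfl
        exact ⟨by omega, by simp⟩
    rw [hfilt, Finset.sum_singleton, pow_zero, Nat.div_one, mul_one, ArithmeticFunction.moebius_apply_one,
      Nat.totient_one, Nat.cast_one, Nat.cast_one, map_one]
    push_cast
    ring

/-- **u034 (identity)** [Z22 p. 105, tex L5202]: "`|κ₂(qʳ)| = |q^{−β₁} − 1|`" — PROVED (`q` prime, `r ≥ 1`);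
the body of `Typed.AppendixA2.StepA_u034a`. [cite: Zhang2022LandauSiegel, App. A p. 105] -/
theorem norm_kappa2_prime_pow {q r : ℕ} (hq : q.Prime) (hr : 1 ≤ r) :
    ‖Section16A.kappa2 c' D (q ^ r)‖ = ‖(q : ℂ) ^ (-Skeleton.beta1 c' D) - 1‖ := by
  obtain ⟨r, rfl⟩ : ∃ r', r = r' + 1 := ⟨r - 1, by omega⟩
  rw [Section16A.kappa2, norm_kappa₂_prime_pow_succ _ hq, cpow_neg_beta1_eq_powI c' hq.ne_zero]

/-- `λ̃₂(q,d)` at a prime: `λ₂(q)` (`= locLam`) if `(q,d) = 1`, else `1` ((16.8)).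
[cite: Zhang2022LandauSiegel, §16 (16.8) p. 91] -/
theorem lamTilde2_prime {q : ℕ} (hq : q.Prime) (d : ℕ) :
    Section16A.lamTilde2 c' χ q d =
      if Nat.Coprime q d then locLam (χ (q : ZMod D)) ((q : ℂ) ^ (-Skeleton.beta1 c' D)) q else 1 := by
  have hq0 : (q : ℂ) ≠ 0 := by exact_mod_cast hq.ne_zero
  unfold Section16A.lamTilde2
  rw [hq.primeFactors]
  by_cases h : Nat.Coprime q d
  · rw [if_pos h, Finset.filter_singleton, if_pos h, Finset.prod_singleton, Section16A.lam2, locLam,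
      hq.primeFactors, Finset.prod_singleton, neg_add, Complex.cpow_add _ _ hq0, Complex.cpow_neg_one]
    ring
  · rw [if_neg h, Finset.filter_singleton, if_neg h, Finset.prod_empty]

end GeneralDL

/-! ## §3. The local series `Σ_{r≥1} ξ₂(qʳ;d,l)q^{−rs}` in closed form, for all `d, l` -/

section LocalSeriesDL

variable (c' : ℝ) {D : ℕ} (χ : DirichletCharacter ℂ D)

/-- **The local series of the Euler factor of `𝔪₂(d,l;s)` at `q`, in closed form**: for `q` prime and
`‖q^{−s}‖ < 1`, `Σ_{r≥1} ξ₂(qʳ;d,l)q^{−rs} = c_d(w−1)x/(1−wx) − [q∤l]·χ(q)q/(q−1)·x(1−x)/(1−wx)`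
(`w = q^{−β₁}`, `x = q^{−s}`, `c_d = (1 − wχ(q)/q)⁻¹` if `(q,d)=1` else `1`), from u033 and the closed form
of `κ̃₂`. [cite: Zhang2022LandauSiegel, App. A p. 105] -/
theorem xi2LocalSeries_prime {q : ℕ} (hq : q.Prime) (d l : ℕ) (s : ℂ) (hx : ‖(q : ℂ) ^ (-s)‖ < 1) :
    Section16A.xi2LocalSeries c' χ q d l s =
      (if Nat.Coprime q d then (1 - (q : ℂ) ^ (-Skeleton.beta1 c' D) * (χ (q : ZMod D) / q))⁻¹ else 1) *
          ((q : ℂ) ^ (-Skeleton.beta1 c' D) - 1) * (q : ℂ) ^ (-s) /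
          (1 - (q : ℂ) ^ (-Skeleton.beta1 c' D) * (q : ℂ) ^ (-s)) -
        (if Nat.Coprime q l then (1 : ℂ) else 0) * (χ (q : ZMod D) * q / ((q : ℂ) - 1)) *
          ((q : ℂ) ^ (-s) * (1 - (q : ℂ) ^ (-s)) / (1 - (q : ℂ) ^ (-Skeleton.beta1 c' D) * (q : ℂ) ^ (-s))) := by
  have hq0 : (q : ℂ) ≠ 0 := by exact_mod_cast hq.ne_zero
  have hwβ : (q : ℂ) ^ (-Skeleton.beta1 c' D) = powI (Skeleton.b1 c' D) q :=
    cpow_neg_beta1_eq_powI c' hq.ne_zero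
  rw [hwβ]
  have hwn : ‖powI (Skeleton.b1 c' D) q‖ = 1 := norm_powI_of_pos _ hq.pos
  have hwx : ‖powI (Skeleton.b1 c' D) q * (q : ℂ) ^ (-s)‖ < 1 := by rw [norm_mul, hwn, one_mul]; exact hx
  have d1 : 1 - powI (Skeleton.b1 c' D) q * (q : ℂ) ^ (-s) ≠ 0 := by
    intro h
    have : ‖powI (Skeleton.b1 c' D) q * (q : ℂ) ^ (-s)‖ = 1 := by rw [← sub_eq_zero.mp h, norm_one]
    linarith
  -- terms: `q^{−rs} = (q^{−s})^r`
  have term : ∀ r : ℕ, (if r = 0 then (0 : ℂ) else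
      Section16A.xi2 c' χ (q ^ r) d l / (q : ℂ) ^ ((r : ℂ) * s)) =
      if r = 0 then 0 else Section16A.xi2 c' χ (q ^ r) d l * ((q : ℂ) ^ (-s)) ^ r := fun r => by
    split_ifs
    · rfl
    · rw [Complex.cpow_nat_mul, div_eq_mul_inv, ← inv_pow, ← Complex.cpow_neg]
  unfold Section16A.xi2LocalSeries
  simp_rw [term]
  -- the shifted terms in closed form
  have exi : ∀ j : ℕ, Section16A.xi2 c' χ (q ^ (j + 1)) d l =
      (if Nat.Coprime q d then (1 - powI (Skeleton.b1 c' D) q * (χ (q : ZMod D) / q))⁻¹ else 1) *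
          (powI (Skeleton.b1 c' D) q ^ j * (powI (Skeleton.b1 c' D) q - 1)) -
        (if Nat.Coprime q l then (1 : ℂ) else 0) * (χ (q : ZMod D) * q / ((q : ℂ) - 1)) *
          kappa₂ (Skeleton.b1 c' D) (q ^ j) := fun j => by
    rw [xi2_prime_pow c' χ d l hq (by omega : 1 ≤ j + 1), Nat.add_sub_cancel,
      kappaTilde2_prime_pow_succ c' χ hq j d, Section16A.kappa2]
    by_cases hl : Nat.Coprime q l
    · rw [if_pos hl, if_pos hl]; ring
    · rw [if_neg hl, if_neg hl]; ring
  have ea : ∀ j : ℕ, Section16A.xi2 c' χ (q ^ (j + 1)) d l * ((q : ℂ) ^ (-s)) ^ (j + 1) =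
      (if Nat.Coprime q d then (1 - powI (Skeleton.b1 c' D) q * (χ (q : ZMod D) / q))⁻¹ else 1) *
            (powI (Skeleton.b1 c' D) q - 1) * (q : ℂ) ^ (-s) *
          (powI (Skeleton.b1 c' D) q * (q : ℂ) ^ (-s)) ^ j -
        (if Nat.Coprime q l then (1 : ℂ) else 0) * (χ (q : ZMod D) * q / ((q : ℂ) - 1)) * (q : ℂ) ^ (-s) *
          (kappa₂ (Skeleton.b1 c' D) (q ^ j) * ((q : ℂ) ^ (-s)) ^ j) := fun j => by
    rw [exi j, pow_succ, mul_pow]; ring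
  have hsum : Summable fun j : ℕ => Section16A.xi2 c' χ (q ^ (j + 1)) d l * ((q : ℂ) ^ (-s)) ^ (j + 1) := by
    simp_rw [ea]
    exact ((summable_geometric_of_norm_lt_one hwx).mul_left _).sub
      ((summable_kappa₂_prime_pow_mul_pow' (Skeleton.b1 c' D) hq hx).mul_left _)
  have hsf : Summable fun r : ℕ =>
      if r = 0 then (0 : ℂ) else Section16A.xi2 c' χ (q ^ r) d l * ((q : ℂ) ^ (-s)) ^ r :=
    (summable_nat_add_iff 1).mp (hsum.congr fun j => (if_neg (Nat.succ_ne_zero j)).symm)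
  rw [hsf.tsum_eq_zero_add, if_pos rfl, zero_add]
  have e1 : ∀ j : ℕ, (if j + 1 = 0 then (0 : ℂ) else
      Section16A.xi2 c' χ (q ^ (j + 1)) d l * ((q : ℂ) ^ (-s)) ^ (j + 1)) =
      Section16A.xi2 c' χ (q ^ (j + 1)) d l * ((q : ℂ) ^ (-s)) ^ (j + 1) := fun j => if_neg (Nat.succ_ne_zero j)
  simp_rw [e1, ea]
  rw [((summable_geometric_of_norm_lt_one hwx).mul_left _).tsum_sub
      ((summable_kappa₂_prime_pow_mul_pow' (Skeleton.b1 c' D) hq hx).mul_left _),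
    tsum_mul_left, tsum_mul_left, tsum_geometric_of_norm_lt_one hwx,
    tsum_kappa₂_prime_pow_mul_pow_zero (Skeleton.b1 c' D) hq hx]
  have d1' : 1 - (q : ℂ) ^ (-s) * powI (Skeleton.b1 c' D) q ≠ 0 := by rwa [mul_comm] at d1
  field_simp

end LocalSeriesDL

end Literature.NumberTheory.LFunctions.Zhang2022.AppendixA
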